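import Literature.NumberTheory.Automorphic.NewformAdelisationHecke
import HarnessLib

/-!
# Hida (2000), Thm 3.26 (2), inertia at `ℓ ∣ N` — part B: the `U_ℓ` identity of the adelic lift

Topic `NumberTheory/EllipticCurves`; a proof file in support of
`Literature.NumberTheory.EllipticCurves.Hida2000_thm326_inertia_of_level` (no named facts).

For a newform `f ∈ S_k(Γ₁(N))` (`IsNewform1`, `T_ℓ f = a_ℓ f`) and a prime `ℓ ∣ N`
(`v ∣ N`, `ℓ = p_v`), the adelic lift `φ_f` of `NewformAdelisationLift` satisfies the
**`U_ℓ`-identity**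
`∑_{j<ℓ} φ_f(h · ι_v(ℓ j; 0 1)) = (a_ℓ / (√ℓ)^{k-2}) φ_f(h)` for every `h ∈ GL₂(𝔸_ℚ)`
(`sum_adelicLiftFun_mul_eq_of_dvd`) — the level-`ℓ` companion of Gelbart's Lemma 3.7
(`sum_adelicLiftFun_mul_eq` of `NewformAdelisationHecke`, `p ∤ N`, `p + 1` cosets), with the `ℓ`
cosets `(ℓ j; 0 1) K₁(ℓ^e)`, `j mod ℓ`, of `K₁(ℓ^e) diag(ℓ,1) K₁(ℓ^e)` (Diamond–Shurman (2005),
Prop. 5.2.1 with `p ∣ N`: `T_p f = ∑_{j<p} f[(1 j; 0 p)]_k`; Miyake (1989), Lemma 4.5.6).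
The proof is the one of `NewformAdelisationHecke`: `h = γ (g_∞, 1) u` (strong approximation),
`u ∈ {1} × K₁(N)` permutes the cosets (`bijOn_range_ofLocal_heckeLocalRep_of_dvd`, the local row
reduction `exists_heckeLocalRep_some_inv_mul_mul_mem_localGammaOne` inside `K₁(N)_ℓ`), and at the
archimedean points the sum is the classical `∑ⱼ f ∣[k] (ℓ j; 0 1)⁻¹ = ℓ^{2-k} T_ℓ f = ℓ^{2-k} a_ℓ f`
(`coe_heckeT_gamma1_eq_sum_of_dvd` of `HeckeOperatorsGamma1QExpansionProofs`).

## References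

* F. Diamond, J. Shurman, *A first course in modular forms*, GTM 228 (2005), Prop. 5.2.1, p. 169
  [DiamondShurman2005].
* S. Gelbart, *Automorphic forms on adele groups* (1975), §3.B, Lemma 3.7 [Gelbart1975].
* H. Hida, *Modular forms and Galois cohomology* (2000), Thm 3.26, p. 152 [Hida2000].
-/

noncomputable section

open Matrix NumberField IsDedekindDomain IsDedekindDomain.HeightOneSpectrum UpperHalfPlane
open scoped MatrixGroups ModularForm

namespace Literature.NumberTheory.EllipticCurves.Hida2000Thm326

open Literature.NumberTheory.Automorphic Literature.NumberTheory.EllipticCurves.ModularForms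
  CongruenceSubgroup Rat.HeightOneSpectrum Matrix.GeneralLinearGroup

/-! ### The local row reduction inside `K₁(𝔫)_v`, `v ∣ 𝔫` -/

section LocalK1

variable {v : HeightOneSpectrum (𝓞 ℚ)} {𝔫 : Ideal (𝓞 ℚ)}

/-- `n(x) = (1 x; 0 1) ∈ K₁(𝔫)_v` for `|x|_v ≤ 1`. [folklore] -/
theorem upperRightHom_mem_localGammaOne {x : v.adicCompletion ℚ} (hx : Valued.v x ≤ 1) :
    (upperRightHom x : GL (Fin 2) (v.adicCompletion ℚ)) ∈ Rat.localGammaOne v 𝔫 := by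
  rw [Rat.mem_localGammaOne_iff]
  obtain ⟨h1, h2, -⟩ := upperRightHom_mem_GL2Int hx
  refine ⟨h1, h2, ?_, ?_⟩
  · rw [upperRightHom_apply]; simp
  · rw [upperRightHom_apply]; simp

/-- The matrix of `(ϖ b_i; 0 1)⁻¹ m diag(ϖ, 1)` for `m = (a b; c d)`:
`(a - b_i c, ϖ⁻¹ (b - b_i d); c ϖ, d)`. [folklore] -/
theorem coe_heckeLocalRep_some_inv_mul_mul_heckeLocalDiag {F : Type*} [Field F] (ϖ : F) {ι : Type*}
    (b : ι → F) (hϖ0 : ϖ ≠ 0) (i : ι) (m : GL (Fin 2) F) :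
    ((((heckeLocalRep ϖ b hϖ0 (some i))⁻¹ * m * heckeLocalDiag ϖ hϖ0 : GL (Fin 2) F)) : Matrix (Fin 2) (Fin 2) F) =
      !![(m : Matrix (Fin 2) (Fin 2) F) 0 0 - b i * (m : Matrix (Fin 2) (Fin 2) F) 1 0,
          ϖ⁻¹ * ((m : Matrix (Fin 2) (Fin 2) F) 0 1 - b i * (m : Matrix (Fin 2) (Fin 2) F) 1 1);
        (m : Matrix (Fin 2) (Fin 2) F) 1 0 * ϖ, (m : Matrix (Fin 2) (Fin 2) F) 1 1] := by
  set a := (m : Matrix (Fin 2) (Fin 2) F) 0 0 with ha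
  set b' := (m : Matrix (Fin 2) (Fin 2) F) 0 1 with hb'
  set c := (m : Matrix (Fin 2) (Fin 2) F) 1 0 with hc
  set d := (m : Matrix (Fin 2) (Fin 2) F) 1 1 with hd
  have hmmat : (m : Matrix (Fin 2) (Fin 2) F) = !![a, b'; c, d] := by
    ext r s; fin_cases r <;> fin_cases s <;> rfl
  rw [Units.val_mul, Units.val_mul, coe_heckeLocalRep_some_inv, coe_heckeLocalDiag, hmmat]
  ext r s
  fin_cases r <;> fin_cases s <;> simp [Matrix.mul_apply, Fin.sum_univ_two] <;> field_simp <;> ring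

/-- **The row reduction inside `K₁(𝔫)_v` at a place `v ∣ 𝔫`** (`|𝔫|_v < 1`): for
`m = (a b; c d) ∈ K₁(𝔫)_v` (so `|d - 1|_v < 1`, `|d|_v = 1`) there is `i < ℓ` with
`(ℓ i; 0 1)⁻¹ m diag(ℓ, 1) = (a - i c, (b - i d)/ℓ; c ℓ, d) ∈ K₁(𝔫)_v`, namely `i ≡ b/d (mod ℓ)` —
the completeness of the `ℓ` cosets `(ℓ i; 0 1) K₁(ℓ^e)` of `K₁(ℓ^e) diag(ℓ,1) K₁(ℓ^e)`
(Diamond–Shurman (2005), (5.2) and Prop. 5.2.1 for `p ∣ N`). [cite: DiamondShurman2005, Prop. 5.2.1] -/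
theorem exists_heckeLocalRep_some_inv_mul_mul_mem_localGammaOne (hrad : idealRadius ℚ v 𝔫 < 1)
    {m : GL (Fin 2) (v.adicCompletion ℚ)} (hm : m ∈ Rat.localGammaOne v 𝔫) :
    ∃ i : Fin (natGenerator v),
      (heckeLocalRep (Rat.localUniformizer v : v.adicCompletion ℚ)
          (fun i : Fin (natGenerator v) => algebraMap ℚ (v.adicCompletion ℚ) ((i : ℕ) : ℚ))
          (Rat.localUniformizer v).ne_zero (some i))⁻¹ * m *
        heckeLocalDiag (Rat.localUniformizer v : v.adicCompletion ℚ) (Rat.localUniformizer v).ne_zero ∈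
      Rat.localGammaOne v 𝔫 := by
  set ϖ : v.adicCompletion ℚ := (Rat.localUniformizer v : v.adicCompletion ℚ) with hϖdef
  set b : Fin (natGenerator v) → v.adicCompletion ℚ :=
    fun i => algebraMap ℚ (v.adicCompletion ℚ) ((i : ℕ) : ℚ) with hbdef
  have hϖ : Valued.v ϖ = WithZero.exp (-1 : ℤ) := Rat.valued_localUniformizer v
  have hϖ0 : ϖ ≠ 0 := (Rat.localUniformizer v).ne_zero
  have hϖ1 : Valued.v ϖ ≤ 1 := by
    rw [hϖ, ← WithZero.exp_zero, WithZero.exp_le_exp]; omega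
  have hvϖ : Valued.v ϖ ≠ 0 := (Valuation.ne_zero_iff _).2 hϖ0
  have hbint : ∀ i, Valued.v (b i) ≤ 1 := fun i => Rat.valued_algebraMap_natCast_le_one v i
  obtain ⟨hm1, -, hm3, hm4⟩ := Rat.mem_localGammaOne_iff.1 hm
  have hdetm := valuation_det_eq_one_of_mem (Rat.localGammaOne_le_valuedCongruenceSubgroup_one v 𝔫 hm)
  have hprod := coe_heckeLocalRep_some_inv_mul_mul_heckeLocalDiag ϖ b hϖ0
  set a := (m : Matrix (Fin 2) (Fin 2) (v.adicCompletion ℚ)) 0 0 with ha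
  set b' := (m : Matrix (Fin 2) (Fin 2) (v.adicCompletion ℚ)) 0 1 with hb'
  set c := (m : Matrix (Fin 2) (Fin 2) (v.adicCompletion ℚ)) 1 0 with hc
  set d := (m : Matrix (Fin 2) (Fin 2) (v.adicCompletion ℚ)) 1 1 with hd
  -- `|d - 1| < 1`, so `|d| = 1`
  have hdeq : Valued.v d = 1 := by
    have hlt : Valued.v (d - 1) < 1 := hm4.trans_lt hrad
    have := Valuation.map_add_eq_of_lt_left Valued.v (x := (1 : v.adicCompletion ℚ)) (y := d - 1)
      (by rwa [Valuation.map_one])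
    rwa [add_sub_cancel, Valuation.map_one] at this
  have hd0 : d ≠ 0 := fun h => by
    rw [h, Valuation.map_zero] at hdeq; exact zero_ne_one hdeq
  obtain ⟨i, hi⟩ := Rat.exists_valued_sub_algebraMap_natCast_lt_one v (b' * d⁻¹)
    (by rw [Valuation.map_mul, map_inv₀, hdeq, inv_one, mul_one]; exact hm1 0 1)
  refine ⟨i, ?_⟩
  replace hprod := hprod i m
  have hdet : Valued.v ((heckeLocalRep ϖ b hϖ0 (some i))⁻¹ * m * heckeLocalDiag ϖ hϖ0).det.val = 1 := by
    rw [map_mul, map_mul, map_inv, Units.val_mul, Units.val_mul, Units.val_inv_eq_inv_val, val_det_heckeLocalRep,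
      val_det_heckeLocalDiag, Valuation.map_mul, Valuation.map_mul, map_inv₀, hdetm, mul_one, inv_mul_cancel₀ hvϖ]
  have hsmall : Valued.v (ϖ⁻¹ * (b' - b i * d)) ≤ 1 := by
    have e : b' - b i * d = (b' * d⁻¹ - b i) * d := by field_simp
    rw [Valuation.map_mul, map_inv₀, e, Valuation.map_mul, hdeq, mul_one]
    have := valuation_le_of_lt_one hϖ hi
    calc (Valued.v ϖ)⁻¹ * Valued.v (b' * d⁻¹ - b i) ≤ (Valued.v ϖ)⁻¹ * Valued.v ϖ := mul_le_mul_right this _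
      _ = 1 := inv_mul_cancel₀ hvϖ
  have h00 : Valued.v (a - b i * c) ≤ 1 := by
    refine (Valuation.map_sub _ _ _).trans (max_le (hm1 0 0) ?_)
    rw [Valuation.map_mul]; exact mul_le_one' (hbint i) (hm1 1 0)
  have hcϖ : Valued.v (c * ϖ) ≤ idealRadius ℚ v 𝔫 := by
    rw [Valuation.map_mul]
    calc Valued.v c * Valued.v ϖ ≤ idealRadius ℚ v 𝔫 * 1 := mul_le_mul' hm3 hϖ1
      _ = _ := mul_one _
  have hint : ∀ r s, Valued.v ((((heckeLocalRep ϖ b hϖ0 (some i))⁻¹ * m * heckeLocalDiag ϖ hϖ0 :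
      GL (Fin 2) (v.adicCompletion ℚ)) : Matrix (Fin 2) (Fin 2) (v.adicCompletion ℚ)) r s) ≤ 1 := by
    intro r s
    rw [hprod]
    fin_cases r <;> fin_cases s
    · simpa using h00
    · simpa using hsmall
    · simpa using hcϖ.trans (idealRadius_le_one' v 𝔫)
    · simpa using hm1 1 1
  have hGL := mem_GL2Int_of_entries hint hdet
  rw [Rat.mem_localGammaOne_iff]
  refine ⟨hint, hGL.2.1, ?_, ?_⟩
  · rw [hprod]; simpa using hcϖ
  · rw [hprod]; simpa using hm4

/-- Distinct `i, j < ℓ` give distinct cosets: `(ℓ i; 0 1)⁻¹ (ℓ j; 0 1) ∈ K₁(𝔫)_v ⊆ GL₂(ℤ_ℓ)` forces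
`i = j`. [folklore] -/
theorem fin_eq_of_heckeLocalRep_inv_mul_mem_localGammaOne {i j : Fin (natGenerator v)}
    (h : (heckeLocalRep (Rat.localUniformizer v : v.adicCompletion ℚ)
          (fun i : Fin (natGenerator v) => algebraMap ℚ (v.adicCompletion ℚ) ((i : ℕ) : ℚ))
          (Rat.localUniformizer v).ne_zero (some i))⁻¹ *
        heckeLocalRep (Rat.localUniformizer v : v.adicCompletion ℚ)
          (fun i : Fin (natGenerator v) => algebraMap ℚ (v.adicCompletion ℚ) ((i : ℕ) : ℚ))
          (Rat.localUniformizer v).ne_zero (some j) ∈ Rat.localGammaOne v 𝔫) : i = j :=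
  Option.some_injective _ (heckeLocalRep_eq_of_inv_mul_mem _ _ (Rat.localUniformizer v).ne_zero
    (Rat.valued_localUniformizer v) (fun _ _ h => Rat.fin_eq_of_valued_sub_lt_one v h)
    (Rat.localGammaOne_le_valuedCongruenceSubgroup_one v 𝔫 h))

end LocalK1

/-! ### The `ℓ` adelic cosets of `U ι_v(diag(ℓ,1)) U`, `U = {1} × K₁(𝔫)`, `v ∣ 𝔫` -/

section AdelicCosets

variable {v : HeightOneSpectrum (𝓞 ℚ)} {𝔫 : Ideal (𝓞 ℚ)}

/-- `ι_v(x) ∈ {1} × K₁(𝔫)` iff `x ∈ K₁(𝔫)_v`. [folklore] -/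
theorem ofLocal_mem_gammaOneLevel_iff {x : GL (Fin 2) (v.adicCompletion ℚ)} :
    GLn.ofLocal 2 ℚ v x ∈ gammaOneLevel ℚ 𝔫 ↔ x ∈ Rat.localGammaOne v 𝔫 := by
  rw [mem_gammaOneLevel_iff, Rat.mem_localGammaOne_iff', GLn.fstHom_ofLocal]
  exact ⟨fun h => h.2, fun h => ⟨rfl, h⟩⟩

/-- The local component at `w` of `u ∈ {1} × K₁(𝔫)` lies in `K₁(𝔫)_w`. [folklore] -/
theorem localPart_mem_localGammaOne_of_mem_gammaOneLevel {u : GL (Fin 2) (AdeleRing (𝓞 ℚ) ℚ)}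
    (hu : u ∈ gammaOneLevel ℚ 𝔫) (w : HeightOneSpectrum (𝓞 ℚ)) :
    GLn.localPart 2 ℚ w u ∈ Rat.localGammaOne w 𝔫 :=
  (Rat.sndHom_mem_gammaOneFiniteLevel_iff_forall_toLocal.1 (mem_gammaOneLevel_iff.1 hu).2) w

/-- `{1} × K₁(𝔫)` is stable under removal of the `v`-component: `u · ι_v(u_v)⁻¹ ∈ {1} × K₁(𝔫)`. [folklore] -/
theorem mul_ofLocal_localPart_inv_mem_gammaOneLevel {u : GL (Fin 2) (AdeleRing (𝓞 ℚ) ℚ)}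
    (hu : u ∈ gammaOneLevel ℚ 𝔫) :
    u * (GLn.ofLocal 2 ℚ v (GLn.localPart 2 ℚ v u))⁻¹ ∈ gammaOneLevel ℚ 𝔫 := by
  have hu' := hu
  rw [mem_gammaOneLevel_iff, Rat.sndHom_mem_gammaOneFiniteLevel_iff_forall_toLocal] at hu' ⊢
  obtain ⟨hu1, hu2⟩ := hu'
  refine ⟨by rw [map_mul, map_inv, hu1, GLn.fstHom_ofLocal, inv_one, mul_one], fun w => ?_⟩
  rw [map_mul, map_inv]
  by_cases hw : w = v
  · subst hw
    rw [GLn.localPart_ofLocal, mul_inv_cancel]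
    exact one_mem _
  · rw [GLn.localPart_ofLocal_of_ne hw, inv_one, mul_one]
    exact hu2 w

/-- **The `ℓ` adelic representatives `ι_v(ℓ j; 0 1)`, `j < ℓ`, form a transversal of the
`U`-orbit of `ι_v(diag(ℓ,1)) U`, `U = {1} × K₁(𝔫)`, at a place `v ∣ 𝔫`** (`|𝔫|_v < 1`):
`K₁(ℓ^e) diag(ℓ,1) K₁(ℓ^e) = ⊔_{j<ℓ} (ℓ j; 0 1) K₁(ℓ^e)` for `e ≥ 1` (Diamond–Shurman (2005), (5.2),
Prop. 5.2.1, case `p ∣ N`; Miyake (1989), Lemma 4.5.6), passed to `GL₂(𝔸_ℚ)` place by place as in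
`bijOn_ofLocal_heckeLocalRep` of `NewformAdelisationHeckeLocal`. [cite: DiamondShurman2005, Prop. 5.2.1] -/
theorem bijOn_range_ofLocal_heckeLocalRep_of_dvd (hrad : idealRadius ℚ v 𝔫 < 1) :
    Set.BijOn (fun y : GL (Fin 2) (AdeleRing (𝓞 ℚ) ℚ) =>
        (y : GL (Fin 2) (AdeleRing (𝓞 ℚ) ℚ) ⧸ gammaOneLevel ℚ 𝔫))
      (Set.range fun j : Fin (natGenerator v) => GLn.ofLocal 2 ℚ v
        (heckeLocalRep (Rat.localUniformizer v : v.adicCompletion ℚ)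
          (fun i : Fin (natGenerator v) => algebraMap ℚ (v.adicCompletion ℚ) ((i : ℕ) : ℚ))
          (Rat.localUniformizer v).ne_zero (some j)))
      (MulAction.orbit (gammaOneLevel ℚ 𝔫)
        ((GLn.ofLocal 2 ℚ v (heckeLocalDiag (Rat.localUniformizer v : v.adicCompletion ℚ)
            (Rat.localUniformizer v).ne_zero) : GL (Fin 2) (AdeleRing (𝓞 ℚ) ℚ)) :
          GL (Fin 2) (AdeleRing (𝓞 ℚ) ℚ) ⧸ gammaOneLevel ℚ 𝔫)) := by
  set ϖ : v.adicCompletion ℚ := (Rat.localUniformizer v : v.adicCompletion ℚ) with hϖdef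
  set b : Fin (natGenerator v) → v.adicCompletion ℚ :=
    fun i => algebraMap ℚ (v.adicCompletion ℚ) ((i : ℕ) : ℚ) with hbdef
  have hϖ0 : ϖ ≠ 0 := (Rat.localUniformizer v).ne_zero
  set U := gammaOneLevel ℚ 𝔫 with hU
  refine ⟨?_, ?_, ?_⟩
  · -- `y_j = ι_v(n(b_j)) · t` with `ι_v(n(b_j)) ∈ U`
    rintro _ ⟨j, rfl⟩
    refine ⟨⟨GLn.ofLocal 2 ℚ v (upperRightHom (b j)), ofLocal_mem_gammaOneLevel_iff.2
      (upperRightHom_mem_localGammaOne (Rat.valued_algebraMap_natCast_le_one v j))⟩, ?_⟩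
    change (((GLn.ofLocal 2 ℚ v (upperRightHom (b j)) * GLn.ofLocal 2 ℚ v (heckeLocalDiag ϖ hϖ0) :
      GL (Fin 2) (AdeleRing (𝓞 ℚ) ℚ)) : GL (Fin 2) (AdeleRing (𝓞 ℚ) ℚ) ⧸ U)) = _
    rw [← map_mul, ← heckeLocalRep_some_eq]
  · -- distinct cosets
    rintro _ ⟨i, rfl⟩ _ ⟨j, rfl⟩ h
    beta_reduce at h
    rw [QuotientGroup.eq] at h
    have h' := localPart_mem_localGammaOne_of_mem_gammaOneLevel h v
    rw [map_mul, map_inv, GLn.localPart_ofLocal, GLn.localPart_ofLocal] at h'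
    rw [fin_eq_of_heckeLocalRep_inv_mul_mem_localGammaOne h']
  · -- every `u t U`, `u ∈ U`, is some `y_j U`
    rintro _ ⟨u, rfl⟩
    set uv := GLn.localPart 2 ℚ v (u : GL (Fin 2) (AdeleRing (𝓞 ℚ) ℚ)) with huv
    obtain ⟨j, hj⟩ := exists_heckeLocalRep_some_inv_mul_mul_mem_localGammaOne hrad
      (localPart_mem_localGammaOne_of_mem_gammaOneLevel u.2 v)
    refine ⟨_, ⟨j, rfl⟩, ?_⟩
    change ((GLn.ofLocal 2 ℚ v (heckeLocalRep ϖ b hϖ0 (some j)) : GL (Fin 2) (AdeleRing (𝓞 ℚ) ℚ) ⧸ U)) =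
      (((u : GL (Fin 2) (AdeleRing (𝓞 ℚ) ℚ)) * GLn.ofLocal 2 ℚ v (heckeLocalDiag ϖ hϖ0) :
        GL (Fin 2) (AdeleRing (𝓞 ℚ) ℚ)) : GL (Fin 2) (AdeleRing (𝓞 ℚ) ℚ) ⧸ U)
    rw [QuotientGroup.eq]
    set k' := (u : GL (Fin 2) (AdeleRing (𝓞 ℚ) ℚ)) * (GLn.ofLocal 2 ℚ v uv)⁻¹ with hk'
    have hk'U : k' ∈ U := mul_ofLocal_localPart_inv_mem_gammaOneLevel u.2
    have hk'v : Matrix.GeneralLinearGroup.map (AdelicGroupData.adeleEval ℚ v) k' = 1 := by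
      change GLn.localPart 2 ℚ v k' = 1
      rw [hk', map_mul, map_inv, GLn.localPart_ofLocal, ← huv, mul_inv_cancel]
    have hu' : (u : GL (Fin 2) (AdeleRing (𝓞 ℚ) ℚ)) = k' * GLn.ofLocal 2 ℚ v uv := by
      rw [hk', inv_mul_cancel_right]
    have comm := GLn.ofLocal_mul_eq_mul_ofLocal_of_toLocal_eq_one (n := 2) (heckeLocalRep ϖ b hϖ0 (some j))⁻¹ hk'v
    have key : (GLn.ofLocal 2 ℚ v (heckeLocalRep ϖ b hϖ0 (some j)))⁻¹ *
        ((u : GL (Fin 2) (AdeleRing (𝓞 ℚ) ℚ)) * GLn.ofLocal 2 ℚ v (heckeLocalDiag ϖ hϖ0)) =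
        k' * GLn.ofLocal 2 ℚ v ((heckeLocalRep ϖ b hϖ0 (some j))⁻¹ * uv * heckeLocalDiag ϖ hϖ0) := by
      calc (GLn.ofLocal 2 ℚ v (heckeLocalRep ϖ b hϖ0 (some j)))⁻¹ *
            ((u : GL (Fin 2) (AdeleRing (𝓞 ℚ) ℚ)) * GLn.ofLocal 2 ℚ v (heckeLocalDiag ϖ hϖ0))
          = (GLn.ofLocal 2 ℚ v (heckeLocalRep ϖ b hϖ0 (some j))⁻¹ * k') *
              (GLn.ofLocal 2 ℚ v uv * GLn.ofLocal 2 ℚ v (heckeLocalDiag ϖ hϖ0)) := by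
            rw [hu', map_inv]; simp only [mul_assoc]
        _ = (k' * GLn.ofLocal 2 ℚ v (heckeLocalRep ϖ b hϖ0 (some j))⁻¹) *
              (GLn.ofLocal 2 ℚ v uv * GLn.ofLocal 2 ℚ v (heckeLocalDiag ϖ hϖ0)) := by rw [comm]
        _ = k' * GLn.ofLocal 2 ℚ v ((heckeLocalRep ϖ b hϖ0 (some j))⁻¹ * uv * heckeLocalDiag ϖ hϖ0) := by
            rw [map_mul, map_mul]; simp only [mul_assoc]
    rw [key]
    exact mul_mem hk'U (ofLocal_mem_gammaOneLevel_iff.2 hj)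

/-- The map `j ↦ ι_v(ℓ j; 0 1)` is injective. [folklore] -/
theorem ofLocal_heckeLocalRep_some_injective :
    Function.Injective fun j : Fin (natGenerator v) => GLn.ofLocal 2 ℚ v
      (heckeLocalRep (Rat.localUniformizer v : v.adicCompletion ℚ)
        (fun i : Fin (natGenerator v) => algebraMap ℚ (v.adicCompletion ℚ) ((i : ℕ) : ℚ))
        (Rat.localUniformizer v).ne_zero (some j)) := by
  intro i j h
  beta_reduce at h
  have h' := congrArg (GLn.localPart 2 ℚ v) h
  rw [GLn.localPart_ofLocal, GLn.localPart_ofLocal] at h'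
  refine fin_eq_of_heckeLocalRep_inv_mul_mem_localGammaOne (𝔫 := ⊤) ?_
  rw [h', inv_mul_cancel]
  exact one_mem _

end AdelicCosets

/-! ### The classical identity `∑_{j<ℓ} f ∣[k] (ℓ j; 0 1)⁻¹ = ℓ^{2-k} a_ℓ f` for `ℓ ∣ N` -/

section ClassicalSum

variable {N : ℕ} {k : ℤ} (p : ℕ) [NeZero p] (hp : p.Prime)

/-- **Diamond–Shurman's Prop. 5.2.1 at `p ∣ N`, through the matrices `β_j = (p j; 0 1)`**: for an
eigenform `f ∈ S_k(Γ₁(N))` of `T_p` (`T_p f = a_p f`) and a prime `p ∣ N`,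
`∑_{j<p} f ∣[k] β_j⁻¹ = p^{2-k} a_p f` (`β_j⁻¹ = p⁻¹ (1 -j; 0 p)` over `ℝ`, and
`T_p f = ∑_{j<p} f[(1 j; 0 p)]_k`, `coe_heckeT_gamma1_eq_sum_of_dvd`). The `β_j` are the values at
`some j` of `heckeBeta p 1 0 1 N` (its Bezout data being irrelevant there). [cite: DiamondShurman2005, Prop. 5.2.1] -/
theorem sum_slash_heckeBeta_some_inv_of_dvd [NeZero N] (had : (1 : ℤ) * 1 - 0 * N = 1) (hpN : p ∣ N)
    {f : CuspForm (Gamma1 N) k} (hT : ∃ a : ℂ, Literature.NumberTheory.EllipticCurves.ModularForms.heckeT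
      (Gamma1 N) k p f = a • f) :
    ∑ j : Fin p, (⇑f : ℍ → ℂ) ∣[k] (Matrix.GeneralLinearGroup.map (Rat.castHom ℝ)
        (heckeBeta p 1 0 1 N hp.ne_zero had (some j)))⁻¹ =
      ((p : ℂ) ^ (2 - k) * heckeEigenvalue f p) • (⇑f : ℍ → ℂ) := by
  have hscalar : (((p : ℝ)⁻¹ : ℝ) : ℂ) ^ (k - 2) = (p : ℂ) ^ (2 - k) := by
    push_cast
    rw [_root_.inv_zpow', neg_sub]
  have hsome : ∀ j : Fin p, (⇑f : ℍ → ℂ) ∣[k] (Matrix.GeneralLinearGroup.map (Rat.castHom ℝ)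
      (heckeBeta p 1 0 1 N hp.ne_zero had (some j)))⁻¹ =
      ((p : ℂ) ^ (2 - k)) • ((⇑f : ℍ → ℂ) ∣[k] tpB p (-((j : ℕ) : ℤ))) := fun j => by
    rw [map_castHom_heckeBeta_some_inv p hp 1 0 1 had j, slash_realScalarGL_mul, hscalar]
  have hT' : (⇑(Literature.NumberTheory.EllipticCurves.ModularForms.heckeT (Gamma1 N) k p f) : ℍ → ℂ) =
      ∑ j : Fin p, (⇑f : ℍ → ℂ) ∣[k] tpB p ((j : ℕ) : ℤ) :=
    coe_heckeT_gamma1_eq_sum_of_dvd N k p hp hpN f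
  have heigen : Literature.NumberTheory.EllipticCurves.ModularForms.heckeT (Gamma1 N) k p f =
      heckeEigenvalue f p • f := heckeT_eq_heckeEigenvalue_smul f p hT
  have hTfun : (⇑(Literature.NumberTheory.EllipticCurves.ModularForms.heckeT (Gamma1 N) k p f) : ℍ → ℂ) =
      heckeEigenvalue f p • (⇑f : ℍ → ℂ) := by
    rw [heigen, CuspForm.IsGLPos.coe_smul]
  simp_rw [hsome]
  rw [← Finset.smul_sum, sum_slash_tpB_neg f p, ← hT', hTfun, smul_smul]

/-- **The archimedean form**: for `det x > 0`,
`∑_{j<p} archLift k f (β_j⁻¹ x) = (a_p / (√p)^{k-2}) archLift k f x` (as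
`sum_archLift_heckeBeta_inv_mul` of `NewformAdelisationHeckeClassical`, from
`sum_slash_heckeBeta_some_inv_of_dvd`). [cite: DiamondShurman2005, Prop. 5.2.1] -/
theorem sum_archLift_heckeBeta_some_inv_mul_of_dvd [NeZero N] (had : (1 : ℤ) * 1 - 0 * N = 1) (hpN : p ∣ N)
    {f : CuspForm (Gamma1 N) k} (hT : ∃ a : ℂ, Literature.NumberTheory.EllipticCurves.ModularForms.heckeT
      (Gamma1 N) k p f = a • f) {x : GL (Fin 2) ℝ} (hx : 0 < x.det.val) :
    ∑ j : Fin p, archLift k f ((Matrix.GeneralLinearGroup.map (Rat.castHom ℝ)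
        (heckeBeta p 1 0 1 N hp.ne_zero had (some j)))⁻¹ * x) =
      (heckeEigenvalue f p / (((Real.sqrt p : ℝ) : ℂ) ^ (k - 2))) * archLift k f x := by
  have hp0 : (0 : ℝ) < p := by exact_mod_cast hp.pos
  have hdetB : ∀ j : Fin p, ((Matrix.GeneralLinearGroup.map (Rat.castHom ℝ)
      (heckeBeta p 1 0 1 N hp.ne_zero had (some j)))⁻¹ * x).det.val = x.det.val / p := fun j => by
    rw [map_mul, map_inv, Units.val_mul, Units.val_inv_eq_inv_val, Matrix.GeneralLinearGroup.map_det, Units.coe_map,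
      MonoidHom.coe_coe, val_det_heckeBeta, Rat.coe_castHom, Rat.cast_natCast, inv_mul_eq_div]
  have hterm : ∀ j : Fin p, archLift k f ((Matrix.GeneralLinearGroup.map (Rat.castHom ℝ)
      (heckeBeta p 1 0 1 N hp.ne_zero had (some j)))⁻¹ * x) =
      (((⇑f : ℍ → ℂ) ∣[k] (Matrix.GeneralLinearGroup.map (Rat.castHom ℝ)
        (heckeBeta p 1 0 1 N hp.ne_zero had (some j)))⁻¹) ∣[k] x)
        UpperHalfPlane.I * ((Real.sqrt (x.det.val / p) : ℝ) : ℂ) ^ (2 - k) := fun j => by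
    rw [archLift_apply, SlashAction.slash_mul, hdetB, abs_of_pos (div_pos hx hp0)]
  simp_rw [hterm]
  rw [← Finset.sum_mul, ← Finset.sum_apply, ← finset_sum_slash,
    sum_slash_heckeBeta_some_inv_of_dvd p hp had hpN hT, ModularForm.smul_slash, UpperHalfPlane.σ, if_pos hx,
    archLift_apply, abs_of_pos hx, Pi.smul_apply, smul_eq_mul]
  change (p : ℂ) ^ (2 - k) * heckeEigenvalue f p * ((⇑f : ℍ → ℂ) ∣[k] x) UpperHalfPlane.I * _ = _
  have hsp : (0 : ℝ) < Real.sqrt p := Real.sqrt_pos.2 hp0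
  have hsp' : ((Real.sqrt p : ℝ) : ℂ) ≠ 0 := by exact_mod_cast hsp.ne'
  have hpC : (p : ℂ) = ((Real.sqrt p : ℝ) : ℂ) ^ (2 : ℤ) := by
    rw [zpow_two, ← Complex.ofReal_mul, Real.mul_self_sqrt hp0.le]; push_cast; ring
  rw [Real.sqrt_div' _ hp0.le, Complex.ofReal_div, div_zpow, hpC, ← _root_.zpow_mul]
  have hkey : ((Real.sqrt p : ℝ) : ℂ) ^ (2 * (2 - k)) * (((Real.sqrt p : ℝ) : ℂ) ^ (2 - k))⁻¹ =
      (((Real.sqrt p : ℝ) : ℂ) ^ (k - 2))⁻¹ := by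
    rw [← _root_.zpow_neg, ← _root_.zpow_neg, ← zpow_add₀ hsp']
    congr 1; ring
  simp only [div_eq_mul_inv]
  linear_combination (heckeEigenvalue f p * ((⇑f : ℍ → ℂ) ∣[k] x) UpperHalfPlane.I *
    ((Real.sqrt x.det.val : ℝ) : ℂ) ^ (2 - k)) * hkey

end ClassicalSum

/-! ### The `U_ℓ` identity of `φ_f` on `GL₂(𝔸_ℚ)` -/

section Pointwise

variable {N : ℕ} [NeZero N] {k : ℤ} {f : CuspForm (Gamma1 N) k} {v : HeightOneSpectrum (𝓞 ℚ)}

/-- **The matching of `β_j = (ℓ j; 0 1)` and `y_j = ι_v(ℓ j; 0 1)` at every finite place**: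
`β_j⁻¹ (y_j)_w ∈ K₁(N)_w` for all `w` — at `w = v` it is `1`, at `w ≠ v` it is
`β_j⁻¹ = diag(ℓ,1)⁻¹ T^{-j} ∈ K₁(N)_w` (`Rat.globalToLocal_diagPrime_mem_localGammaOne`,
`Γ₁(N) ⊆ K₁(N)_w`). [cite: Gelbart1975, Lemma 3.7 (proof)] -/
theorem globalToLocal_heckeBeta_some_inv_mul_mem_localGammaOne (had : (1 : ℤ) * 1 - 0 * N = 1)
    (j : Fin (natGenerator v)) (w : HeightOneSpectrum (𝓞 ℚ)) :
    Rat.globalToLocal 2 w (heckeBeta (natGenerator v) 1 0 1 N (prime_natGenerator v).ne_zero had (some j))⁻¹ *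
        GLn.localPart 2 ℚ w (GLn.ofLocal 2 ℚ v
          (heckeLocalRep (Rat.localUniformizer v : v.adicCompletion ℚ)
            (fun i : Fin (natGenerator v) => algebraMap ℚ (v.adicCompletion ℚ) ((i : ℕ) : ℚ))
            (Rat.localUniformizer v).ne_zero (some j))) ∈
      Rat.localGammaOne w (Ideal.span {(N : 𝓞 ℚ)}) := by
  by_cases hw : w = v
  · subst hw
    rw [GLn.localPart_ofLocal, map_inv, Rat.globalToLocal_heckeBeta_some had j, inv_mul_cancel]
    exact one_mem _
  · rw [GLn.localPart_ofLocal_of_ne hw, mul_one, Rat.heckeBeta_some_eq had j, _root_.mul_inv_rev, map_mul, map_inv,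
      ← map_inv (Matrix.SpecialLinearGroup.mapGL ℚ), ← _root_.zpow_neg]
    refine mul_mem (inv_mem (Rat.globalToLocal_diagPrime_mem_localGammaOne hw _)) ?_
    rw [← GLn.localPart_ofGlobal]
    exact Rat.localPart_ofGlobal_mapGL_mem_localGammaOne (HeckeTGamma1.T_zpow_mem_Gamma1 N _) w

/-- **The `U_ℓ` identity at the archimedean points**: for `T_ℓ f = a_ℓ f`, `ℓ ∣ N` and `det g_∞ > 0`,
`∑_{j<ℓ} φ_f((g_∞, 1) y_j) = ∑ⱼ archLift k f (β_j⁻¹ g_∞) = (a_ℓ / (√ℓ)^{k-2}) φ_f((g_∞, 1))`.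
[cite: DiamondShurman2005, Prop. 5.2.1] -/
theorem sum_adelicLiftFun_ofRealGL_mul_eq_of_dvd (hv : v.asIdeal ∣ Ideal.span {(N : 𝓞 ℚ)})
    (hT : ∃ a : ℂ, (haveI : NeZero (natGenerator v) := ⟨(prime_natGenerator v).ne_zero⟩;
      Literature.NumberTheory.EllipticCurves.ModularForms.heckeT (Gamma1 N) k (natGenerator v) f) = a • f)
    {g : GL (Fin 2) ℝ} (hg : 0 < g.det.val) :
    ∑ j : Fin (natGenerator v), adelicLiftFun N k f (Rat.ofRealGL 2 g * GLn.ofLocal 2 ℚ v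
      (heckeLocalRep (Rat.localUniformizer v : v.adicCompletion ℚ)
        (fun i : Fin (natGenerator v) => algebraMap ℚ (v.adicCompletion ℚ) ((i : ℕ) : ℚ))
        (Rat.localUniformizer v).ne_zero (some j))) =
      (heckeEigenvalue f (natGenerator v) / (((Real.sqrt (natGenerator v) : ℝ) : ℂ) ^ (k - 2))) *
        adelicLiftFun N k f (Rat.ofRealGL 2 g) := by
  haveI : NeZero (natGenerator v) := ⟨(prime_natGenerator v).ne_zero⟩
  have hpN : natGenerator v ∣ N := (Rat.natGenerator_dvd_iff v N).2 hv
  have had : (1 : ℤ) * 1 - 0 * N = 1 := by ring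
  have hterm : ∀ j : Fin (natGenerator v), adelicLiftFun N k f (Rat.ofRealGL 2 g * GLn.ofLocal 2 ℚ v
      (heckeLocalRep (Rat.localUniformizer v : v.adicCompletion ℚ)
        (fun i : Fin (natGenerator v) => algebraMap ℚ (v.adicCompletion ℚ) ((i : ℕ) : ℚ))
        (Rat.localUniformizer v).ne_zero (some j))) =
      archLift k f ((Matrix.GeneralLinearGroup.map (Rat.castHom ℝ)
        (heckeBeta (natGenerator v) 1 0 1 N (prime_natGenerator v).ne_zero had (some j)))⁻¹ * g) := fun j =>
    adelicLiftFun_ofRealGL_mul_eq_archLift f hg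
      (by rw [val_det_heckeBeta]; exact_mod_cast (prime_natGenerator v).pos)
      (Rat.archGL_ofLocal_heckeLocalRep (some j))
      (globalToLocal_heckeBeta_some_inv_mul_mem_localGammaOne had j)
  simp_rw [hterm]
  rw [sum_archLift_heckeBeta_some_inv_mul_of_dvd (natGenerator v) (prime_natGenerator v) had hpN hT hg,
    adelicLiftFun_ofRealGL f hg]

/-- **The `U_ℓ` identity of the adelic lift, pointwise on `GL₂(𝔸_ℚ)`**: for a cusp form
`f ∈ S_k(Γ₁(N))` with `T_ℓ f = a_ℓ f`, a place `v ∣ N` (`ℓ = p_v`) and every `h ∈ GL₂(𝔸_ℚ)`,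
`∑_{j<ℓ} φ_f(h · ι_v(ℓ j; 0 1)) = (a_ℓ / (√ℓ)^{k-2}) φ_f(h)` — i.e. `ℓ^{k/2-1} U_ℓ φ_f = φ_{T_ℓ f} = a_ℓ φ_f`:
write `h = γ (g_∞, 1) u` (`Rat.exists_ofGlobal_inv_mul_mem_plusLevelOne`), drop `γ` by left
invariance, move `u ∈ {1} × K₁(N)` through the `y_j` (it permutes the cosets `y_j ({1} × K₁(N))`,
`bijOn_range_ofLocal_heckeLocalRep_of_dvd`, `sum_apply_mul_mul_eq_of_bijOn_cosets`), drop it by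
right invariance, and conclude by `sum_adelicLiftFun_ofRealGL_mul_eq_of_dvd`. [cite: DiamondShurman2005, Prop. 5.2.1]
[cite: Gelbart1975, Lemma 3.7] -/
theorem sum_adelicLiftFun_mul_eq_of_dvd (hv : v.asIdeal ∣ Ideal.span {(N : 𝓞 ℚ)})
    (hT : ∃ a : ℂ, (haveI : NeZero (natGenerator v) := ⟨(prime_natGenerator v).ne_zero⟩;
      Literature.NumberTheory.EllipticCurves.ModularForms.heckeT (Gamma1 N) k (natGenerator v) f) = a • f)
    (h : GL (Fin 2) (AdeleRing (𝓞 ℚ) ℚ)) :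
    ∑ j : Fin (natGenerator v), adelicLiftFun N k f (h * GLn.ofLocal 2 ℚ v
      (heckeLocalRep (Rat.localUniformizer v : v.adicCompletion ℚ)
        (fun i : Fin (natGenerator v) => algebraMap ℚ (v.adicCompletion ℚ) ((i : ℕ) : ℚ))
        (Rat.localUniformizer v).ne_zero (some j))) =
      (heckeEigenvalue f (natGenerator v) / (((Real.sqrt (natGenerator v) : ℝ) : ℂ) ^ (k - 2))) *
        adelicLiftFun N k f h := by
  have h𝔫 : Ideal.span {(N : 𝓞 ℚ)} ≠ 0 := Rat.span_natCast_ne_zero N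
  have hrad : idealRadius ℚ v (Ideal.span {(N : 𝓞 ℚ)}) < 1 := by
    rw [idealRadius, ← WithZero.exp_zero, WithZero.exp_lt_exp, neg_lt_zero, FractionalIdeal.count_coe ℚ v h𝔫,
      Nat.cast_pos, Nat.pos_iff_ne_zero]
    exact (Associates.count_ne_zero_iff_dvd h𝔫 v.irreducible).2 hv
  -- `h = γ h₀`, `h₀ ∈ GL₂(ℝ)⁺ × K₁(N)`
  obtain ⟨γ, hγ⟩ := Rat.exists_ofGlobal_inv_mul_mem_plusLevelOne (Ideal.span {(N : 𝓞 ℚ)}) h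
  set h₀ : GL (Fin 2) (AdeleRing (𝓞 ℚ) ℚ) := (GLn.ofGlobal 2 ℚ γ)⁻¹ * h with hh₀
  have hh : h = GLn.ofGlobal 2 ℚ γ * h₀ := by rw [hh₀, mul_inv_cancel_left]
  have hred : ∀ z, adelicLiftFun N k f (h * z) = adelicLiftFun N k f (h₀ * z) := fun z => by
    rw [hh, mul_assoc, adelicLiftFun_ofGlobal_mul]
  have hred₀ : adelicLiftFun N k f h = adelicLiftFun N k f h₀ := by
    simpa only [mul_one] using hred 1
  simp_rw [hred]
  rw [hred₀]
  -- `h₀ = (g_∞, 1) u`, `u ∈ {1} × K₁(N)`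
  have hdet : 0 < (Rat.archGL 2 h₀).det.val := (Rat.mem_plusLevelOne_iff.1 hγ).1
  set g : GL (Fin 2) ℝ := Rat.archGL 2 h₀
  set u : GL (Fin 2) (AdeleRing (𝓞 ℚ) ℚ) := (Rat.ofRealGL 2 g)⁻¹ * h₀ with hudef
  have hu : u ∈ gammaOneLevel ℚ (Ideal.span {(N : 𝓞 ℚ)}) := Rat.ofRealGL_archGL_inv_mul_mem_gammaOneLevel hγ
  have hh₀' : h₀ = Rat.ofRealGL 2 g * u := by rw [hudef, mul_inv_cancel_left]
  rw [hh₀']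
  simp_rw [mul_assoc]
  rw [sum_apply_mul_mul_eq_of_bijOn_cosets _ _ (bijOn_range_ofLocal_heckeLocalRep_of_dvd hrad)
      ofLocal_heckeLocalRep_some_injective (adelicLiftFun N k f)
      (fun x z hz => adelicLiftFun_mul_of_mem_gammaOneLevel f x hz) hu,
    adelicLiftFun_mul_of_mem_gammaOneLevel f _ hu]
  exact sum_adelicLiftFun_ofRealGL_mul_eq_of_dvd hv hT hdet

/-- **The `U_ℓ` identity for a newform** `f ∈ S_k(Γ₁(N))` (`IsNewform1`), `v ∣ N`:
`∑_{j<ℓ} φ_f(h · ι_v(ℓ j; 0 1)) = (a_ℓ(f) / (√ℓ)^{k-2}) φ_f(h)`. [cite: DiamondShurman2005, Prop. 5.2.1] -/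
theorem sum_adelicLiftFun_mul_eq_of_isNewform1_of_dvd (hf : IsNewform1 f) (hv : v.asIdeal ∣ Ideal.span {(N : 𝓞 ℚ)})
    (h : GL (Fin 2) (AdeleRing (𝓞 ℚ) ℚ)) :
    ∑ j : Fin (natGenerator v), adelicLiftFun N k f (h * GLn.ofLocal 2 ℚ v
      (heckeLocalRep (Rat.localUniformizer v : v.adicCompletion ℚ)
        (fun i : Fin (natGenerator v) => algebraMap ℚ (v.adicCompletion ℚ) ((i : ℕ) : ℚ))
        (Rat.localUniformizer v).ne_zero (some j))) =
      (heckeEigenvalue f (natGenerator v) / (((Real.sqrt (natGenerator v) : ℝ) : ℂ) ^ (k - 2))) *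
        adelicLiftFun N k f h :=
  sum_adelicLiftFun_mul_eq_of_dvd hv (hf.2.1 (natGenerator v) (prime_natGenerator v)) h

end Pointwise

end Literature.NumberTheory.EllipticCurves.Hida2000Thm326
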